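import Mathlib.NumberTheory.AbelSummation
import Mathlib.MeasureTheory.Integral.IntegralEqImproper
import Mathlib.MeasureTheory.Integral.Asymptotics
import Mathlib.MeasureTheory.Integral.Bochner.ContinuousLinearMap
import Mathlib.Analysis.SpecialFunctions.Gaussian.GaussianIntegral
import Literature.NumberTheory.LFunctions.HardyLittlewoodCriterionNecessityProofs
import HarnessLib

/-!
# RH-EQUIVALENT (PROVED AS AN EQUIVALENCE) · Báez-Duarte's general convolution equivalence `BaezDuarte2005Moebius_eq_3_15`: "RH ⟺ `Gφ(x) ≪ x^{−1/2+ε}` for every proper `φ`" DISCHARGED (`BaezDuarte2005Moebius_eq_3_15_holds`) — nothing here bears on the truth of RH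

Literature-typing tranche `rh-lit-broughan-2` (Broughan, *Equivalents of the Riemann Hypothesis*,
Vol. 2, Ch. 2 §2.5 "A General Theorem for a Class of Entire Functions", Index "Báez-Duarte convolution
criterion 3, 17"; Báez-Duarte, *Möbius-convolutions and the Riemann hypothesis*, IJMMS 2005:22 =
arXiv:math/0504402). The typed named fact `BaezDuarte2005Moebius_eq_3_15` (file
`RieszTypeSeriesCriteria`) reads
`RiemannHypothesis ↔ ∀ φ proper, ∀ ε > 0, Gφ = O(x^{−1/2+ε})`, where `g(x) = Σ_{n≤x} μ(n)/n`
(`moebiusDivSum`), `Gφ(x) = ∫₀^∞ g(xt) φ(1/t) dt/t` (`moebiusConv`) and "proper" means measurable with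
`N_σ(φ) = ∫₀^∞ x^{−σ−1}|φ(x)| dx < ∞` for `σ ∈ (−1/2, 0]` (`IsMoebiusProper`). This file PROVES both
directions (D-0026 discharge; no new definition, no new fact):

* "⟹" = Báez-Duarte's (3.12) [§3.1: "`|Gφ(x)| ≤ ∫ |g(xt)| |φ(1/t)| dt/t ≪ x^{−1/2+ε} N_{−1/2+ε}(φ)`
  on RH, by Littlewood's `g(x) ≪ x^{−1/2+ε}` ((2.3))"]: the tree PROVES Littlewood's bound
  (`abs_sum_moebius_div_le_of_riemannHypothesis`, file `HardyLittlewoodCriterionNecessityProofs`), and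
  the substitution `t ↦ 1/t` (Mathlib `integral_comp_rpow_Ioi`, `p = −1`) turns the majorant into
  `N_{−1/2+ε}(φ)` (§1–§2).
* "⟸": Báez-Duarte's (3.7) "`H(x²) = Gβ(x)`, `β(x) = −2x²e^{−x²}`" [§3.1, the Hardy–Littlewood case]
  — `β` is proper (§3), the identity is Abel summation of `H(x²) = Σ (μ(n)/n)(e^{−x²/n²} − 1)` against
  `g` (Mathlib `tendsto_sum_mul_atTop_nhds_one_sub_integral₀`) followed by `t ↦ xt` (§4) — so the
  hypothesis at `φ = β` gives `H(y) ≪ y^{−1/4+ε/2}`, and the tree's PROVED Hardy–Littlewood sufficiency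
  `riemannHypothesis_of_hardyLittlewoodFunction_isBigO` (`HardyLittlewoodCriterionProofs`) yields RH (§5).
  (Báez-Duarte derives "⟸" for every *Mellin-proper* `φ` (Thm 3.1 = `BaezDuarte2005Moebius_thm_3_1`,
  not discharged here); for (3.15) one proper test function with a known sufficiency theorem is
  enough, and `β` is the printed one.)

* §1 `moebiusDivSum_eq_sum_range`, `abs_moebiusDivSum_le_self`, `abs_moebiusDivSum_le_rpow_of_riemannHypothesis`.
* §2 `norm_moebiusConv_le_of_bound`, `moebiusConv_isBigO_of_riemannHypothesis` ("⟹", (3.12)).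
* §3 `isMoebiusProper_hlBeta` (`β` is proper).
* §4 `hardyLittlewoodFunction_eq_neg_integral` (Abel summation), `moebiusConv_hlBeta_eq` ((3.7)).
* §5 `riemannHypothesis_of_forall_proper_moebiusConv_isBigO` ("⟸"), **`BaezDuarte2005Moebius_eq_3_15_holds`**.

## References

* [BaezDuarte2005Moebius] L. Báez-Duarte, *Möbius-convolutions and the Riemann hypothesis*, IJMMS
  2005:22, 3599–3608 (arXiv:math/0504402), §2 (2.2)–(2.3), §3.1 (3.1), (3.6)–(3.7), (3.12), (3.15)
  [corpus: paper:arxiv-math_0504402 pp. 2–7].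
* [HardyLittlewood1916] G. H. Hardy, J. E. Littlewood, Acta Math. 41, §2.5 (2.545).
* [Titchmarsh1986] E. C. Titchmarsh, *The Theory of the Riemann Zeta-Function*, 2nd ed., §14.25, §14.32.
* [Broughan2017] K. Broughan, *Equivalents of the Riemann Hypothesis*, Vol. 2, §2.5 (secondary; not held).
-/

noncomputable section

open Filter Asymptotics Finset Topology MeasureTheory Set

open scoped Real Nat

namespace Literature.NumberTheory.LFunctions

/-! ## §1 Littlewood's function `g(x) = Σ_{n≤x} μ(n)/n` -/

/-- `g(x) = Σ_{j ≤ ⌊x⌋} μ(j)/j` with the (vanishing) `j = 0` term included. [cite: BaezDuarte2005Moebius, §2 (definition of g)] -/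
theorem moebiusDivSum_eq_sum_range (x : ℝ) :
    moebiusDivSum x = ∑ j ∈ range (⌊x⌋₊ + 1), ((ArithmeticFunction.moebius j : ℤ) : ℝ) / j := by
  unfold moebiusDivSum
  induction ⌊x⌋₊ with
  | zero => simp
  | succ N ih =>
    rw [Finset.sum_Icc_succ_top (by omega), ih, Finset.sum_range_succ _ (N + 1)]

/-- The trivial bound `|g(x)| ≤ x` for `x ≥ 0` (each term has modulus `≤ 1`).
[cite: BaezDuarte2005Moebius, §2 (g bounded)] -/
theorem abs_moebiusDivSum_le_self {x : ℝ} (hx : 0 ≤ x) : |moebiusDivSum x| ≤ x := by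
  unfold moebiusDivSum
  calc |∑ n ∈ Icc 1 ⌊x⌋₊, ((ArithmeticFunction.moebius n : ℤ) : ℝ) / n|
      ≤ ∑ n ∈ Icc 1 ⌊x⌋₊, |((ArithmeticFunction.moebius n : ℤ) : ℝ) / n| := abs_sum_le_sum_abs _ _
    _ ≤ ∑ n ∈ Icc 1 ⌊x⌋₊, (1 : ℝ) := by
        refine Finset.sum_le_sum fun n hn ↦ ?_
        have hn1 : (1 : ℝ) ≤ n := by exact_mod_cast (Finset.mem_Icc.1 hn).1
        rw [abs_div, Nat.abs_cast]
        have hμ : |((ArithmeticFunction.moebius n : ℤ) : ℝ)| ≤ 1 := by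
          exact_mod_cast ArithmeticFunction.abs_moebius_le_one
        exact (div_le_one (by linarith)).2 (hμ.trans hn1)
    _ = ⌊x⌋₊ := by simp
    _ ≤ x := Nat.floor_le hx

/-- **Littlewood's bound on `g` under RH, for real arguments:** for `0 < ε < 1/2` there is `C` with
`|g(u)| ≤ C u^{−1/2+ε}` for all `u ≥ 1` (from the tree's integer-point bound
`abs_sum_moebius_div_le_of_riemannHypothesis`, `g(u) = g(⌊u⌋)` and `⌊u⌋ ≥ u/2`).
[cite: BaezDuarte2005Moebius, §2 eq. (2.3) (RH ⟹ g(x) ≪ x^{−1/2+ε}); Titchmarsh1986 Thm 14.25] -/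
theorem abs_moebiusDivSum_le_rpow_of_riemannHypothesis (hRH : RiemannHypothesis) {ε : ℝ}
    (hε : 0 < ε) (hε1 : ε < 1 / 2) :
    ∃ C : ℝ, 0 ≤ C ∧ ∀ u : ℝ, 1 ≤ u → |moebiusDivSum u| ≤ C * u ^ (-(1 / 2 : ℝ) + ε) := by
  obtain ⟨C', hC'0, hC'⟩ := abs_sum_moebius_div_le_of_riemannHypothesis hRH hε hε1
  refine ⟨2 * C', by positivity, fun u hu ↦ ?_⟩
  have hu0 : 0 < u := by linarith
  set N : ℕ := ⌊u⌋₊ with hN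
  have hN1 : 1 ≤ N := by rw [hN]; exact Nat.le_floor (by exact_mod_cast hu)
  have hNr : (1 : ℝ) ≤ N := by exact_mod_cast hN1
  have hNu : u / 2 ≤ N := by
    have h1 : u < (N : ℝ) + 1 := by rw [hN]; exact Nat.lt_floor_add_one u
    linarith
  have he : -(1 / 2 : ℝ) + ε ≤ 0 := by linarith
  rw [moebiusDivSum_eq_sum_range]
  have h2e : (2 : ℝ) ^ (-(-(1 / 2 : ℝ) + ε)) ≤ 2 := by
    calc (2 : ℝ) ^ (-(-(1 / 2 : ℝ) + ε)) ≤ (2 : ℝ) ^ (1 : ℝ) :=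
          Real.rpow_le_rpow_of_exponent_le one_le_two (by linarith)
      _ = 2 := Real.rpow_one 2
  calc |∑ j ∈ range (N + 1), ((ArithmeticFunction.moebius j : ℤ) : ℝ) / j|
      ≤ C' * (N : ℝ) ^ (-(1 / 2 : ℝ) + ε) := hC' N hN1
    _ ≤ C' * (u / 2) ^ (-(1 / 2 : ℝ) + ε) :=
        mul_le_mul_of_nonneg_left (Real.rpow_le_rpow_of_nonpos (by linarith) hNu he) hC'0
    _ = C' * ((2 : ℝ) ^ (-(-(1 / 2 : ℝ) + ε)) * u ^ (-(1 / 2 : ℝ) + ε)) := by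
        rw [Real.div_rpow hu0.le zero_le_two, Real.rpow_neg zero_le_two, div_eq_mul_inv, mul_comm
          (u ^ _)]
    _ ≤ C' * (2 * u ^ (-(1 / 2 : ℝ) + ε)) := by gcongr
    _ = 2 * C' * u ^ (-(1 / 2 : ℝ) + ε) := by ring

/-! ## §2 "⟹": `|Gφ(x)| ≤ C N_{−1/2+ε}(φ) x^{−1/2+ε}` (Báez-Duarte (3.12)) -/

/-- The majorant computation of (3.12): if `|g(u)| ≤ C u^e` for `u ≥ 1` (`g = 0` on `[0,1)`) and `N := ∫₀^∞ u^{−e−1}|φ(u)| du < ∞`, then `|Gφ(x)| ≤ C N x^e` for every `x > 0`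
(`|Gφ(x)| ≤ ∫₀^∞ |g(xt)||φ(1/t)| dt/t ≤ C x^e ∫₀^∞ t^{e−1}|φ(1/t)| dt`, and `t ↦ 1/t`).
[cite: BaezDuarte2005Moebius, §3.1 eq. (3.12) (majorant via N_σ(φ))] -/
theorem norm_moebiusConv_le_of_bound {f : ℝ → ℂ} {C e : ℝ} (hC0 : 0 ≤ C)
    (hg : ∀ u : ℝ, 1 ≤ u → |moebiusDivSum u| ≤ C * u ^ e)
    (hN : IntegrableOn (fun u : ℝ ↦ u ^ (-e - 1) * ‖f u‖) (Ioi 0)) {x : ℝ} (hx : 0 < x) :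
    ‖moebiusConv f x‖ ≤ C * (∫ u in Ioi (0 : ℝ), u ^ (-e - 1) * ‖f u‖) * x ^ e := by
  -- the bound on `g` at all `u ≥ 0`
  have hg' : ∀ u : ℝ, 0 ≤ u → |moebiusDivSum u| ≤ C * u ^ e := by
    intro u hu
    rcases lt_or_ge u 1 with h1 | h1
    · rw [moebiusDivSum_of_lt_one h1, abs_zero]; positivity
    · exact hg u h1
  -- the substitution `t ↦ 1/t`: pointwise identity of the two integrands on `(0, ∞)`
  have hsub : ∀ t ∈ Ioi (0 : ℝ), (|(-1 : ℝ)| * t ^ ((-1 : ℝ) - 1)) •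
      ((fun u : ℝ ↦ u ^ (-e - 1) * ‖f u‖) (t ^ (-1 : ℝ))) = t ^ (e - 1) * ‖f (1 / t)‖ := by
    intro t ht
    have ht0 : (0 : ℝ) < t := ht
    simp only [smul_eq_mul, abs_neg, abs_one, one_mul]
    rw [Real.rpow_neg_one, ← one_div, Real.div_rpow zero_le_one ht0.le, Real.one_rpow]
    have h1 : t ^ ((-1 : ℝ) - 1) * (1 / t ^ (-e - 1)) = t ^ (e - 1) := by
      rw [one_div, ← Real.rpow_neg ht0.le, ← Real.rpow_add ht0]; ring_nf
    rw [← mul_assoc, h1]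
  have hint : IntegrableOn (fun t : ℝ ↦ t ^ (e - 1) * ‖f (1 / t)‖) (Ioi 0) := by
    have h := (integrableOn_Ioi_comp_rpow_iff (fun u : ℝ ↦ u ^ (-e - 1) * ‖f u‖)
      (by norm_num : (-1 : ℝ) ≠ 0)).2 hN
    exact h.congr_fun hsub measurableSet_Ioi
  have hval : ∫ t in Ioi (0 : ℝ), t ^ (e - 1) * ‖f (1 / t)‖ =
      ∫ u in Ioi (0 : ℝ), u ^ (-e - 1) * ‖f u‖ := by
    rw [← integral_comp_rpow_Ioi (fun u : ℝ ↦ u ^ (-e - 1) * ‖f u‖) (by norm_num : (-1 : ℝ) ≠ 0)]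
    exact (setIntegral_congr_fun measurableSet_Ioi hsub).symm
  -- the majorant
  have hmaj : ∀ᵐ t ∂(volume.restrict (Ioi (0 : ℝ))),
      ‖(moebiusDivSum (x * t) : ℂ) * f (1 / t) / t‖ ≤ C * x ^ e * (t ^ (e - 1) * ‖f (1 / t)‖) := by
    refine ae_restrict_of_forall_mem measurableSet_Ioi fun t (ht : 0 < t) ↦ ?_
    have hxt : 0 ≤ x * t := by positivity
    rw [norm_div, norm_mul, Complex.norm_real, Complex.norm_real, Real.norm_eq_abs,
      Real.norm_of_nonneg ht.le]
    have h1 := hg' (x * t) hxt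
    rw [Real.mul_rpow hx.le ht.le] at h1
    calc |moebiusDivSum (x * t)| * ‖f (1 / t)‖ / t ≤ C * (x ^ e * t ^ e) * ‖f (1 / t)‖ / t := by
          gcongr
      _ = C * x ^ e * (t ^ e * t ^ (-1 : ℝ) * ‖f (1 / t)‖) := by
          rw [Real.rpow_neg_one]; ring
      _ = C * x ^ e * (t ^ (e - 1) * ‖f (1 / t)‖) := by
          rw [← Real.rpow_add ht]; ring_nf
  calc ‖moebiusConv f x‖ ≤ ∫ t in Ioi (0 : ℝ), C * x ^ e * (t ^ (e - 1) * ‖f (1 / t)‖) :=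
        norm_integral_le_of_norm_le (hint.const_mul _) hmaj
    _ = C * x ^ e * ∫ t in Ioi (0 : ℝ), t ^ (e - 1) * ‖f (1 / t)‖ := integral_const_mul _ _
    _ = C * (∫ u in Ioi (0 : ℝ), u ^ (-e - 1) * ‖f u‖) * x ^ e := by rw [hval]; ring

/-- **"⟹" of (3.15) = Báez-Duarte's (3.12) (PROVED):** under RH, `Gφ(x) ≪ x^{−1/2+ε}` for every
proper `φ` and every `ε > 0`. [cite: BaezDuarte2005Moebius, §3.1 eq. (3.12)] -/
theorem moebiusConv_isBigO_of_riemannHypothesis (hRH : RiemannHypothesis) {f : ℝ → ℂ}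
    (hf : IsMoebiusProper f) {ε : ℝ} (hε : 0 < ε) :
    moebiusConv f =O[atTop] fun x : ℝ ↦ x ^ (-(1 / 2 : ℝ) + ε) := by
  -- reduce to `ε < 1/2`
  wlog hε1 : ε < 1 / 2 generalizing ε with H
  · have h1 := H (ε := 1 / 4) (by norm_num) (by norm_num)
    refine h1.trans (IsBigO.of_bound 1 ?_)
    filter_upwards [eventually_ge_atTop (1 : ℝ)] with x hx
    rw [one_mul, Real.norm_of_nonneg (by positivity), Real.norm_of_nonneg (by positivity)]
    exact Real.rpow_le_rpow_of_exponent_le hx (by linarith)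
  set e : ℝ := -(1 / 2 : ℝ) + ε with he
  obtain ⟨C, hC0, hC⟩ := abs_moebiusDivSum_le_rpow_of_riemannHypothesis hRH hε hε1
  have hN : IntegrableOn (fun u : ℝ ↦ u ^ (-e - 1) * ‖f u‖) (Ioi 0) :=
    hf.2 e (by rw [he]; linarith) (by rw [he]; linarith)
  refine IsBigO.of_bound (C * ∫ u in Ioi (0 : ℝ), u ^ (-e - 1) * ‖f u‖) ?_
  filter_upwards [eventually_gt_atTop (0 : ℝ)] with x hx
  rw [Real.norm_of_nonneg (Real.rpow_nonneg hx.le _)]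
  exact norm_moebiusConv_le_of_bound hC0 hC hN hx

/-! ## §3 The Hardy–Littlewood test function `β(x) = −2x²e^{−x²}` is proper -/

/-- `β(x) = −2x²e^{−x²}` (Báez-Duarte (3.7)) is proper: measurable, and
`N_σ(β) = 2∫₀^∞ x^{1−σ} e^{−x²} dx < ∞` for `σ ∈ (−1/2, 0]` (indeed for all `σ < 2`).
[cite: BaezDuarte2005Moebius, §3.1 eq. (3.7) (β is proper; Mellin transform computed there)] -/
theorem isMoebiusProper_hlBeta :
    IsMoebiusProper (fun u : ℝ ↦ (((-2 * u ^ 2 * Real.exp (-u ^ 2)) : ℝ) : ℂ)) := by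
  refine ⟨(Complex.continuous_ofReal.comp (by fun_prop)).measurable, fun σ hσ1 hσ2 ↦ ?_⟩
  unfold HasFiniteMellinNorm
  have h : IntegrableOn (fun x : ℝ ↦ 2 * (x ^ (1 - σ) * Real.exp (-1 * x ^ 2))) (Ioi 0) :=
    (integrableOn_rpow_mul_exp_neg_mul_sq one_pos (by linarith : (-1 : ℝ) < 1 - σ)).const_mul 2
  refine IntegrableOn.congr_fun h (fun u (hu : 0 < u) ↦ ?_) measurableSet_Ioi
  have hβ : ‖(((-2 * u ^ 2 * Real.exp (-u ^ 2)) : ℝ) : ℂ)‖ = 2 * u ^ 2 * Real.exp (-u ^ 2) := by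
    rw [Complex.norm_real, Real.norm_eq_abs, show -2 * u ^ 2 * Real.exp (-u ^ 2) =
      -(2 * u ^ 2 * Real.exp (-u ^ 2)) by ring, abs_neg, abs_of_nonneg (by positivity)]
  rw [hβ, show (-1 : ℝ) * u ^ 2 = -u ^ 2 by ring]
  have hpow : u ^ (-σ - 1) * u ^ 2 = u ^ (1 - σ) := by
    rw [← Real.rpow_natCast u 2, ← Real.rpow_add hu]
    simp only [Nat.cast_ofNat]
    ring_nf
  calc 2 * (u ^ (1 - σ) * Real.exp (-u ^ 2)) = 2 * (u ^ (-σ - 1) * u ^ 2) * Real.exp (-u ^ 2) := by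
        rw [hpow]; ring
    _ = u ^ (-σ - 1) * (2 * u ^ 2 * Real.exp (-u ^ 2)) := by ring

/-! ## §4 `Gβ(x) = H(x²)` (Báez-Duarte (3.7)): Abel summation and the substitution `t ↦ xt` -/

/-- Real form of the tree's `hardyLittlewoodFunction_eq_tsum_moebius`, as a `HasSum`:
`H(X) = Σ_n (e^{−X/n²} − 1)(μ(n)/n)`. [cite: Titchmarsh1986, §14.32 (14.32.3)] -/
theorem hasSum_hardyLittlewoodFunction_real (X : ℝ) (hX : 0 ≤ X) :
    HasSum (fun n : ℕ ↦ (Real.exp (-(X / (n : ℝ) ^ 2)) - 1) *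
      (((ArithmeticFunction.moebius n : ℤ) : ℝ) / n)) (hardyLittlewoodFunction X) := by
  set f : ℕ → ℝ := fun n ↦ Real.exp (-(X / (n : ℝ) ^ 2)) - 1 with hf
  set c : ℕ → ℝ := fun n ↦ ((ArithmeticFunction.moebius n : ℤ) : ℝ) / n with hc
  have hc1 : ∀ n : ℕ, |c n| ≤ 1 := fun n ↦ by
    simp only [hc]
    rcases Nat.eq_zero_or_pos n with rfl | hn
    · simp
    · rw [abs_div, Nat.abs_cast]
      have hμ : |((ArithmeticFunction.moebius n : ℤ) : ℝ)| ≤ 1 := by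
        exact_mod_cast ArithmeticFunction.abs_moebius_le_one
      have hn1 : (1 : ℝ) ≤ n := by exact_mod_cast hn
      exact (div_le_one (by linarith)).2 (hμ.trans hn1)
  have hfabs : ∀ n : ℕ, 1 ≤ n → |f n| ≤ X / (n : ℝ) ^ 2 := fun n hn ↦ by
    have hy : 0 ≤ X / (n : ℝ) ^ 2 := by positivity
    have h1 : Real.exp (-(X / (n : ℝ) ^ 2)) ≤ 1 := Real.exp_le_one_iff.2 (by linarith)
    have h2 : -(X / (n : ℝ) ^ 2) + 1 ≤ Real.exp (-(X / (n : ℝ) ^ 2)) := Real.add_one_le_exp _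
    simp only [hf]
    rw [abs_of_nonpos (by linarith)]
    linarith
  have hsumm : Summable fun n ↦ f n * c n := by
    refine Summable.of_norm_bounded (g := fun n : ℕ ↦ X * (1 / (n : ℝ) ^ 2))
      ((Real.summable_one_div_nat_pow.2 one_lt_two).mul_left X) fun n ↦ ?_
    rw [Real.norm_eq_abs, abs_mul]
    rcases Nat.eq_zero_or_pos n with rfl | hn
    · simp [hc]
    · have hx2 : 0 ≤ X / (n : ℝ) ^ 2 := by positivity
      calc |f n| * |c n| ≤ X / (n : ℝ) ^ 2 * 1 :=
            mul_le_mul (hfabs n hn) (hc1 n) (abs_nonneg _) hx2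
        _ = X * (1 / (n : ℝ) ^ 2) := by ring
  have hF : hardyLittlewoodFunction X = ∑' n, f n * c n := by
    have h := hardyLittlewoodFunction_eq_tsum_moebius X
    have h2 : ((∑' n, f n * c n : ℝ) : ℂ) = ∑' n : ℕ, ((ArithmeticFunction.moebius n : ℤ) : ℂ) *
        ((((Real.exp (-(X / (n : ℝ) ^ 2)) - 1) / n : ℝ) : ℂ)) := by
      rw [Complex.ofReal_tsum]
      refine tsum_congr fun n ↦ ?_
      simp only [hf, hc]
      push_cast
      ring
    exact_mod_cast h.trans h2.symm
  rw [hF]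
  exact hsumm.hasSum

/-- **Abel summation of `H`:** for `X > 0`,
`H(X) = −∫₁^∞ (d/dt (e^{−X/t²} − 1)) g(t) dt = −∫₁^∞ e^{−X/t²} (2X/t³) g(t) dt`
(the boundary terms vanish: `|e^{−X/n²} − 1| |g(n)| ≤ X/n`). In the Mathlib shape of
`tendsto_sum_mul_atTop_nhds_one_sub_integral₀` (`g(t) = Σ_{k≤⌊t⌋} μ(k)/k`).
[cite: BaezDuarte2005Moebius, §3.1 (3.1) and (3.7) (G as an integral against g); Titchmarsh1986 §14.32] -/
theorem hardyLittlewoodFunction_eq_neg_integral {X : ℝ} (hX : 0 < X) :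
    hardyLittlewoodFunction X =
      -∫ t in Ioi (1 : ℝ), deriv (fun t : ℝ ↦ Real.exp (-(X / t ^ 2)) - 1) t *
        ∑ k ∈ Icc 0 ⌊t⌋₊, ((ArithmeticFunction.moebius k : ℤ) : ℝ) / k := by
  set f : ℝ → ℝ := fun t ↦ Real.exp (-(X / t ^ 2)) - 1 with hf
  set c : ℕ → ℝ := fun k ↦ ((ArithmeticFunction.moebius k : ℤ) : ℝ) / k with hc
  have hc0 : c 0 = 0 := by simp [hc]
  -- the partial sums are `g`
  have hcS : ∀ t : ℝ, ∑ k ∈ Icc 0 ⌊t⌋₊, c k = moebiusDivSum t := fun t ↦ by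
    rw [moebiusDivSum_eq_sum_range, Nat.range_succ_eq_Icc_zero]
  -- derivative of `f`
  have hderiv : ∀ t : ℝ, t ≠ 0 → deriv f t = Real.exp (-(X / t ^ 2)) * (2 * X / t ^ 3) :=
    fun t ht ↦ (hasDerivAt_hlWeight X ht).deriv
  have hf_diff : ∀ t ∈ Ici (1 : ℝ), DifferentiableAt ℝ f t := fun t ht ↦
    (hasDerivAt_hlWeight X (by linarith [mem_Ici.1 ht] : t ≠ 0)).differentiableAt
  have hcont : ContinuousOn (fun t : ℝ ↦ Real.exp (-(X / t ^ 2)) * (2 * X / t ^ 3)) (Ici 1) := by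
    have hne : ∀ t ∈ Ici (1 : ℝ), t ≠ 0 := fun t ht ↦ by linarith [mem_Ici.1 ht]
    refine ContinuousOn.mul ?_ ?_
    · refine Real.continuous_exp.comp_continuousOn (ContinuousOn.neg ?_)
      exact continuousOn_const.div (continuousOn_pow 2) fun t ht ↦ pow_ne_zero 2 (hne t ht)
    · exact continuousOn_const.div (continuousOn_pow 3) fun t ht ↦ pow_ne_zero 3 (hne t ht)
  have hf_int : LocallyIntegrableOn (deriv f) (Ici 1) := by
    refine (hcont.congr fun t ht ↦ hderiv t ?_).locallyIntegrableOn measurableSet_Ici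
    linarith [mem_Ici.1 ht]
  -- boundary terms
  have h_lim : Tendsto (fun n : ℕ ↦ f n * ∑ k ∈ Icc 0 n, c k) atTop (𝓝 0) := by
    have hlim : Tendsto (fun n : ℕ ↦ X / (n : ℝ)) atTop (𝓝 0) := tendsto_const_div_atTop_nhds_zero_nat X
    refine squeeze_zero_norm' ?_ hlim
    filter_upwards [eventually_ge_atTop 1] with n hn
    have hn0 : (0 : ℝ) < n := by exact_mod_cast hn
    have hS : |∑ k ∈ Icc 0 n, c k| ≤ n := by
      have := hcS n
      rw [Nat.floor_natCast] at this
      rw [this]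
      exact abs_moebiusDivSum_le_self hn0.le
    have hfn : |f n| ≤ X / (n : ℝ) ^ 2 := by
      have hy : 0 ≤ X / (n : ℝ) ^ 2 := by positivity
      have h1 : Real.exp (-(X / (n : ℝ) ^ 2)) ≤ 1 := Real.exp_le_one_iff.2 (by linarith)
      have h2 : -(X / (n : ℝ) ^ 2) + 1 ≤ Real.exp (-(X / (n : ℝ) ^ 2)) := Real.add_one_le_exp _
      simp only [hf]
      rw [abs_of_nonpos (by linarith)]
      linarith
    rw [Real.norm_eq_abs, abs_mul]
    calc |f n| * |∑ k ∈ Icc 0 n, c k| ≤ X / (n : ℝ) ^ 2 * n :=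
          mul_le_mul hfn hS (abs_nonneg _) (by positivity)
      _ = X / n := by field_simp
  -- domination of the integrand by `2X t^{-2}`
  have hg_dom : (fun t : ℝ ↦ deriv f t * ∑ k ∈ Icc 0 ⌊t⌋₊, c k) =O[atTop]
      fun t : ℝ ↦ 2 * X * t ^ (-2 : ℝ) := by
    refine IsBigO.of_bound 1 ?_
    filter_upwards [eventually_ge_atTop (1 : ℝ)] with t ht
    have ht0 : 0 < t := by linarith
    rw [hderiv t ht0.ne', hcS, one_mul, Real.norm_eq_abs, abs_mul,
      Real.norm_of_nonneg (by positivity)]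
    have h1 : |Real.exp (-(X / t ^ 2)) * (2 * X / t ^ 3)| ≤ 2 * X / t ^ 3 := by
      rw [abs_mul, Real.abs_exp, abs_of_pos (by positivity : (0 : ℝ) < 2 * X / t ^ 3)]
      have : Real.exp (-(X / t ^ 2)) ≤ 1 := Real.exp_le_one_iff.2 (by
        have : 0 ≤ X / t ^ 2 := by positivity
        linarith)
      calc Real.exp (-(X / t ^ 2)) * (2 * X / t ^ 3) ≤ 1 * (2 * X / t ^ 3) := by gcongr
        _ = 2 * X / t ^ 3 := one_mul _
    calc |Real.exp (-(X / t ^ 2)) * (2 * X / t ^ 3)| * |moebiusDivSum t| ≤ 2 * X / t ^ 3 * t :=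
          mul_le_mul h1 (abs_moebiusDivSum_le_self ht0.le) (abs_nonneg _) (by positivity)
      _ = 2 * X * t ^ (-2 : ℝ) := by
          rw [show (-2 : ℝ) = -(2 : ℕ) by norm_num, Real.rpow_neg ht0.le, Real.rpow_natCast]
          field_simp
  have hg_int : IntegrableAtFilter (fun t : ℝ ↦ 2 * X * t ^ (-2 : ℝ)) atTop :=
    ⟨Ioi 1, Ioi_mem_atTop 1, (integrableOn_Ioi_rpow_of_lt (by norm_num) one_pos).const_mul _⟩
  -- Abel summation (Mathlib)
  have habel := tendsto_sum_mul_atTop_nhds_one_sub_integral₀ c hc0 hf_diff hf_int h_lim hg_dom hg_int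
  -- the same partial sums tend to `H(X)`
  have hH : Tendsto (fun n : ℕ ↦ ∑ k ∈ Icc 0 n, f k * c k) atTop (𝓝 (hardyLittlewoodFunction X)) := by
    have h := ((hasSum_hardyLittlewoodFunction_real X hX.le).tendsto_sum_nat).comp
      (tendsto_add_atTop_nat 1)
    refine h.congr fun n ↦ ?_
    simp only [Function.comp_apply, Nat.range_succ_eq_Icc_zero, hf, hc]
  have := tendsto_nhds_unique hH habel
  rw [this, zero_sub]

/-- **Báez-Duarte's (3.7): `Gβ(x) = H(x²)`** for `x > 0`, `β(u) = −2u²e^{−u²}`: after `u = xt`,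
`Gβ(x) = ∫₀^∞ g(u) β(x/u) du/u = −∫₀^∞ g(u) e^{−x²/u²} (2x²/u³) du`, and `g = 0` on `(0,1)`.
[cite: BaezDuarte2005Moebius, §3.1 eq. (3.7) (H(x²) = Gβ(x))] -/
theorem moebiusConv_hlBeta_eq {x : ℝ} (hx : 0 < x) :
    moebiusConv (fun u : ℝ ↦ (((-2 * u ^ 2 * Real.exp (-u ^ 2)) : ℝ) : ℂ)) x =
      (hardyLittlewoodFunction (x ^ 2) : ℂ) := by
  set X : ℝ := x ^ 2 with hXdef
  have hX : 0 < X := by positivity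
  set f : ℝ → ℝ := fun t ↦ Real.exp (-(X / t ^ 2)) - 1 with hf
  set c : ℕ → ℝ := fun k ↦ ((ArithmeticFunction.moebius k : ℤ) : ℝ) / k with hc
  set G : ℝ → ℝ := fun u ↦ deriv f u * ∑ k ∈ Icc 0 ⌊u⌋₊, c k with hG
  have hc0 : c 0 = 0 := by simp [hc]
  have hcS : ∀ t : ℝ, ∑ k ∈ Icc 0 ⌊t⌋₊, c k = moebiusDivSum t := fun t ↦ by
    rw [moebiusDivSum_eq_sum_range, Nat.range_succ_eq_Icc_zero]
  have hderiv : ∀ t : ℝ, t ≠ 0 → deriv f t = Real.exp (-(X / t ^ 2)) * (2 * X / t ^ 3) :=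
    fun t ht ↦ (hasDerivAt_hlWeight X ht).deriv
  -- `H(X) = -∫_{Ioi 1} G`
  have hH : hardyLittlewoodFunction X = -∫ u in Ioi (1 : ℝ), G u :=
    hardyLittlewoodFunction_eq_neg_integral hX
  -- integrability of `G` on `[1, ∞)` (as in Mathlib's Abel summation) and vanishing on `(0,1)`
  have hcont : ContinuousOn (fun t : ℝ ↦ Real.exp (-(X / t ^ 2)) * (2 * X / t ^ 3)) (Ici 1) := by
    have hne : ∀ t ∈ Ici (1 : ℝ), t ≠ 0 := fun t ht ↦ by linarith [mem_Ici.1 ht]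
    refine ContinuousOn.mul ?_ ?_
    · refine Real.continuous_exp.comp_continuousOn (ContinuousOn.neg ?_)
      exact continuousOn_const.div (continuousOn_pow 2) fun t ht ↦ pow_ne_zero 2 (hne t ht)
    · exact continuousOn_const.div (continuousOn_pow 3) fun t ht ↦ pow_ne_zero 3 (hne t ht)
  have hf_int : LocallyIntegrableOn (deriv f) (Ici 1) := by
    refine (hcont.congr fun t ht ↦ hderiv t ?_).locallyIntegrableOn measurableSet_Ici
    linarith [mem_Ici.1 ht]
  have hg_dom : G =O[atTop] fun t : ℝ ↦ 2 * X * t ^ (-2 : ℝ) := by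
    refine IsBigO.of_bound 1 ?_
    filter_upwards [eventually_ge_atTop (1 : ℝ)] with t ht
    have ht0 : 0 < t := by linarith
    simp only [hG]
    rw [hderiv t ht0.ne', hcS, one_mul, Real.norm_eq_abs, abs_mul,
      Real.norm_of_nonneg (by positivity)]
    have h1 : |Real.exp (-(X / t ^ 2)) * (2 * X / t ^ 3)| ≤ 2 * X / t ^ 3 := by
      rw [abs_mul, Real.abs_exp, abs_of_pos (by positivity : (0 : ℝ) < 2 * X / t ^ 3)]
      have : Real.exp (-(X / t ^ 2)) ≤ 1 := Real.exp_le_one_iff.2 (by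
        have : 0 ≤ X / t ^ 2 := by positivity
        linarith)
      calc Real.exp (-(X / t ^ 2)) * (2 * X / t ^ 3) ≤ 1 * (2 * X / t ^ 3) := by gcongr
        _ = 2 * X / t ^ 3 := one_mul _
    calc |Real.exp (-(X / t ^ 2)) * (2 * X / t ^ 3)| * |moebiusDivSum t| ≤ 2 * X / t ^ 3 * t :=
          mul_le_mul h1 (abs_moebiusDivSum_le_self ht0.le) (abs_nonneg _) (by positivity)
      _ = 2 * X * t ^ (-2 : ℝ) := by
          rw [show (-2 : ℝ) = -(2 : ℕ) by norm_num, Real.rpow_neg ht0.le, Real.rpow_natCast]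
          field_simp
  have hg_int : IntegrableAtFilter (fun t : ℝ ↦ 2 * X * t ^ (-2 : ℝ)) atTop :=
    ⟨Ioi 1, Ioi_mem_atTop 1, (integrableOn_Ioi_rpow_of_lt (by norm_num) one_pos).const_mul _⟩
  have hGint : IntegrableOn G (Ici 1) :=
    (locallyIntegrableOn_mul_sum_Icc c zero_le_one hf_int).integrableOn_of_isBigO_atTop hg_dom hg_int
  have hG0 : ∀ u ∈ Ioo (0 : ℝ) 1, G u = 0 := by
    intro u hu
    simp only [hG]
    rw [Nat.floor_eq_zero.2 hu.2, Finset.Icc_self, Finset.sum_singleton, hc0, mul_zero]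
  have hGint0 : IntegrableOn G (Ioo 0 1) :=
    integrableOn_zero.congr_fun (fun u hu ↦ (hG0 u hu).symm) measurableSet_Ioo
  -- `∫_{Ioi 0} G = ∫_{Ioi 1} G`
  have hsplit : ∫ u in Ioi (0 : ℝ), G u = ∫ u in Ioi (1 : ℝ), G u := by
    have hdisj : Disjoint (Ioo (0 : ℝ) 1) (Ici 1) :=
      Set.disjoint_left.2 fun u hu hu' ↦ (not_le.2 hu.2) (mem_Ici.1 hu')
    rw [← Ioo_union_Ici_eq_Ioi zero_lt_one, setIntegral_union hdisj measurableSet_Ici hGint0 hGint,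
      setIntegral_eq_zero_of_forall_eq_zero hG0, zero_add, integral_Ici_eq_integral_Ioi]
  -- the integrand of `Gβ(x)` is `(-x) · G(xt)`
  have hpt : ∀ t ∈ Ioi (0 : ℝ),
      (moebiusDivSum (x * t) : ℂ) * (((-2 * (1 / t) ^ 2 * Real.exp (-(1 / t) ^ 2)) : ℝ) : ℂ) / t =
        (((-x) * G (x * t) : ℝ) : ℂ) := by
    intro t ht
    have ht0 : (0 : ℝ) < t := ht
    have hxt : x * t ≠ 0 := by positivity
    simp only [hG]
    rw [hderiv (x * t) hxt, hcS]
    push_cast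
    have e1 : -(((x : ℂ) ^ 2) / ((x : ℂ) * t) ^ 2) = -((1 / (t : ℂ)) ^ 2) := by
      have hx' : (x : ℂ) ≠ 0 := Complex.ofReal_ne_zero.2 hx.ne'
      have ht' : (t : ℂ) ≠ 0 := Complex.ofReal_ne_zero.2 ht0.ne'
      field_simp
    rw [hXdef]
    push_cast
    rw [e1]
    have hx' : (x : ℂ) ≠ 0 := Complex.ofReal_ne_zero.2 hx.ne'
    have ht' : (t : ℂ) ≠ 0 := Complex.ofReal_ne_zero.2 ht0.ne'
    field_simp
  -- assemble
  unfold moebiusConv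
  rw [setIntegral_congr_fun measurableSet_Ioi hpt, integral_complex_ofReal, integral_const_mul,
    integral_comp_mul_left_Ioi G 0 hx, mul_zero, hsplit, smul_eq_mul, hH]
  have hx' : (x : ℂ) ≠ 0 := Complex.ofReal_ne_zero.2 hx.ne'
  push_cast
  field_simp

/-! ## §5 "⟸" and the discharge -/

/-- **"⟸" of (3.15) (PROVED):** if `Gφ(x) ≪ x^{−1/2+ε}` for every proper `φ` and every `ε > 0`,
then RH — apply the hypothesis to `β` (`Gβ(x) = H(x²)`), obtaining `H(y) ≪ y^{−1/4+δ}` for every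
`δ > 0`, and use the Hardy–Littlewood sufficiency theorem of the tree.
[cite: BaezDuarte2005Moebius, eq. (3.15) with (3.7) ("immediately proves the … Hardy–Littlewood criteria"); HardyLittlewood1916 §2.5] -/
theorem riemannHypothesis_of_forall_proper_moebiusConv_isBigO
    (h : ∀ f : ℝ → ℂ, IsMoebiusProper f →
      ∀ ε : ℝ, 0 < ε → moebiusConv f =O[atTop] fun x : ℝ ↦ x ^ (-(1 / 2 : ℝ) + ε)) :
    RiemannHypothesis := by
  refine riemannHypothesis_of_hardyLittlewoodFunction_isBigO fun δ hδ ↦ ?_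
  have hG := h _ isMoebiusProper_hlBeta (2 * δ) (by linarith)
  obtain ⟨C, hCpos, hC⟩ := hG.exists_pos
  rw [isBigOWith_iff, eventually_atTop] at hC
  obtain ⟨X₀, hX₀⟩ := hC
  refine IsBigO.of_bound C ?_
  filter_upwards [eventually_ge_atTop (max 1 (X₀ ^ 2))] with y hy
  have hy1 : 1 ≤ y := (le_max_left _ _).trans hy
  have hy0 : 0 < y := by linarith
  have hsy : X₀ ≤ Real.sqrt y := by
    rcases le_or_gt X₀ 0 with h0 | h0
    · exact h0.trans (Real.sqrt_nonneg y)
    · rw [← Real.sqrt_sq h0.le]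
      exact Real.sqrt_le_sqrt ((le_max_right _ _).trans hy)
  have h1 := hX₀ (Real.sqrt y) hsy
  rw [moebiusConv_hlBeta_eq (Real.sqrt_pos.2 hy0), Real.sq_sqrt hy0.le, Complex.norm_real] at h1
  have hexp : ‖Real.sqrt y ^ (-(1 / 2 : ℝ) + 2 * δ)‖ = ‖y ^ (-(1 / 4 : ℝ) + δ)‖ := by
    rw [Real.norm_of_nonneg (Real.rpow_nonneg (Real.sqrt_nonneg y) _),
      Real.norm_of_nonneg (Real.rpow_nonneg hy0.le _), Real.sqrt_eq_rpow, ← Real.rpow_mul hy0.le]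
    congr 1
    ring
  rw [hexp] at h1
  exact h1

/-- **DISCHARGE of the named fact `BaezDuarte2005Moebius_eq_3_15`** (Báez-Duarte 2005, (3.15): "one also
has the following general equivalence: RH ⟺ (`Gφ(x) ≪ x^{−1/2+ε}`, ∀ proper `φ`)"; Broughan Vol. 2
§2.5 / Index "Báez-Duarte convolution criterion"): a THEOREM of the tree — "⟹" by (3.12) from
Littlewood's `g ≪ x^{−1/2+ε}`, "⟸" by `φ = β` and the Hardy–Littlewood criterion. An equivalence is
proved; neither side is asserted. [cite: BaezDuarte2005Moebius, eq. (3.15); Broughan2017 Vol. 2 §2.5] -/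
theorem BaezDuarte2005Moebius_eq_3_15_holds : BaezDuarte2005Moebius_eq_3_15 :=
  ⟨fun hRH _f hf _ε hε ↦ moebiusConv_isBigO_of_riemannHypothesis hRH hf hε,
    riemannHypothesis_of_forall_proper_moebiusConv_isBigO⟩

/-- **Báez-Duarte 2005, Thm 3.5 (arXiv Thm 3.1) — the necessity half for mellin-proper test
functions** ((3.12): "RH ⟹ `Gφ(x) ≪ x^{−1/2+ε}`" for every proper `φ`, in particular for every
mellin-proper one), PROVED: the `→` direction of the inner equivalence of the named fact
`BaezDuarte2005Moebius_thm_3_1`. (The `←` direction for a general mellin-proper `φ` needs the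
continuation of `(Gφ)^∧(s) = φ^∧(s)/(sζ(s+1))` off the line `σ = 0` and remains a named fact.)
[cite: BaezDuarte2005Moebius, Thm. 3.5 (arXiv Thm. 3.1, (3.12) ⟹ (3.13))] -/
theorem BaezDuarte2005Moebius_thm_3_1.mp_holds {f : ℝ → ℂ} (hf : IsMellinProper f)
    (hRH : RiemannHypothesis) {ε : ℝ} (hε : 0 < ε) :
    moebiusConv f =O[atTop] fun x : ℝ ↦ x ^ (-(1 / 2 : ℝ) + ε) :=
  moebiusConv_isBigO_of_riemannHypothesis hRH hf.1 hε

end Literature.NumberTheory.LFunctions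

end
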